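import Literature.Barriers.RiemannHypothesis.FeketePolyaPositivityEven
import HarnessLib

/-!
# Rosser's twisted Fekete–Pólya criteria (J. Res. Nat. Bur. Standards 45 (1950), Theorems 5–6), proved — barrier audit of `FeketePolyaPositivity`

Sibling of `Literature/Barriers/RiemannHypothesis/FeketePolyaPositivity.lean` (catalogue entry
`FeketePolyaPositivity`: the Fekete–Pólya positivity technique `S_k(N, χ) ≥ 0 ⟹ L(σ, χ) > 0` and
Heilbronn's obstruction `P(0.7, χ_{−163}) < 0`, which kills EVERY order `k` for `χ_{−163}`), of
`FeketePolyaPositivityProofs.lean` (order `1` proved) and `FeketePolyaPositivityEven.lean` (order `2`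
proved). Written for the second barrier audit (2026-08-16), which READ the paper Montgomery–Vaughan
cite at the end of Exercise 11.2.1.8 ("See also Rosser (1950)") and found that it is not a mere
numerical verification: it contains two positivity techniques OUTSIDE the family the barrier entry
proves to fail. Everything in this file is PROVED; it declares no definitions.

## What Rosser (1950) does (read: J. Res. NBS 45 (1950) 505–514, Research Paper 2165)

* §II "Generalization of Chowla's Method" (pp. 505–508). Theorems 3–4 are the Fekete–Pólya /
  Chowla mechanism (`Γ(s)L(s, φ) = ∫_0^∞ x^{s−1} f(x, φ) dx`, `f(x, φ) = ∑ φ(n)e^{−nx} =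
  (1 − e^{−x})^r f(x, φ_r)` with `φ_r` the `r`-fold iterated sums); p. 506: "As noted by Heilbronn
  in [4], there exist values of `k` such that no `χ_r(n)` is nonnegative for every `n ≥ 1`. In fact
  one can prove that `k = 163` is such a `k`; for actual computation for `k = 163` discloses that
  `f(log(10/7), χ)` is negative ... Our efforts to find an `r` for the cases `k = 43, 67, 88, 123,
  148, 173, 187, 188,` and `197` were sufficiently unrewarded that we suspect that for these values
  of `k` also there is no `r`. At any rate we devised an improvement of Chowla's method to handle
  these intractable `k`'s (except perhaps `k = 163`). **Theorem 5.** If `F(s) = ∫_0^∞ x^{s−1} f(x) dx`,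
  then `(1 + a r^{−s})F(s) = ∫_0^∞ x^{s−1}{f(x) + a f(rx)} dx`." Theorem 6 (p. 507) identifies the
  coefficients `θ(n)` of `(1 + a r^{−s})L(s, φ)`; the worked example `k = 67` uses
  `(1 + 2^{−s})(1 + 3^{−s})(1 + 5^{−s})Γ(s)L(s, χ) = ∫ x^{s−1} f(x, η) dx` with `η_3(n) ≥ 0`, hence
  "`L(s, χ) > 0` for `s > 0`"; `k = 43` uses `(1 + 2^{−s})(1 + 3^{−s})`, `r = 2`. With such products
  every `k ≤ 227` other than `163` was settled; for `k = 163` "the combination ... will require at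
  least five factors, and likely more than five, and the computations involved appear to be very
  extensive. So we sought other methods" (pp. 507–508).
* §III "Another Method" (pp. 508–510): with `c_n ≥ 0` the coefficients of `ζ(s)L(s, χ)` (`c_1 = 1`)
  and a Bessel-`K_0` kernel, `ξ(s)ξ(s, χ) = ∫_0^∞ x^{s−1} j(x) dx` with `j > 0` decreasing
  (Theorem 8), whence (Theorem 12 ff.) "by a very simple reasoning, which does not even involve
  inspection of the values of `χ`, that for `k ≤ 39`, `L(s, χ)` has no positive real zeros ...
  Unfortunately, this method is not general. In particular, it fails for `k = 163`."
* §IV "Treatment of `k = 163`" (pp. 510–511): `g(x) = ξ(1, χ) − x j(x)` changes sign exactly once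
  (Lemmas 1–3), so `ξ(s)ξ(s, χ)/(1 + a^s)` is monotone and "**Lemma 5.** If `L(s, χ)` is positive
  for `s = 1/2`, then it is positive for `s > 0`"; the value `L(1/2, χ_{−163}) = 0.06910` was then
  computed. (Abstract: "a new formula for `L(s, χ)` was discovered that made it possible to treat
  many values of `k` simultaneously. By means of this formula, the difficult case of `k = 163` was
  finally treated adequately.")

So, for the barrier catalogue: Heilbronn's obstruction (`FeketePolyaPositivity`) covers the
UNTWISTED kernels `P(z, χ)(1 − z)^{−k}` only. Rosser's TWISTS — multiplication of `L(s, χ)` by a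
Dirichlet polynomial `D(s) = 1 + ∑ a_r r^{−s}` with `a_r ≥ 0` before asking for nonnegative
(iterated) coefficient sums — contain Chowla's induced characters as the special case
`D = ∏_{p ∣ m}(1 − χ(p)p^{−s})` with `χ(p) = −1` (`FeketePolyaPositivityChowla*.lean`), but general
weights (any `r`, any `a_r ≥ 0`; Rosser's Theorem 5 allows arbitrary `a ≥ 0`) form a much larger,
finitely checkable family, and the `ζ_K`-side positive kernel of §§III–IV is a different mechanism
again, which does dispose of `k = 163` given one central value.

## What is proved here

* `sum_range_mul_apply_div_mul_rpow_sub` — the block identity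
  `∑_{N < rV} S(⌊N/r⌋)(N^{−σ} − (N+1)^{−σ}) = r^{−σ} ∑_{v < V} S(v)(v^{−σ} − (v+1)^{−σ})`.
* `hasSum_summatory_div_mul_rpow_sub` — Rosser's Theorem 5 in discrete (Abel-sum) form for
  Mathlib's analytically continued `L`: for `χ ≠ χ₀`, `r ≥ 1`, `σ > 0`,
  `∑_{N ≥ 1} S_1(⌊N/r⌋, χ)(N^{−σ} − (N+1)^{−σ}) = r^{−σ} Re L(σ, χ)` (from the tree's
  `Literature.NumberTheory.LFunctions.DirichletAbel.LFunction_eq_abelSum`, MV Thm. 4.8).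
* `LFunction_re_pos_of_twisted_summatory_nonneg` — **twisted criterion, order one**: if
  `S_1(N, χ) + ∑_{r ∈ R} a_r S_1(⌊N/r⌋, χ) ≥ 0` for all `N ≥ 1` (`R` finite, `r ≥ 1`, `a_r ≥ 0`), then
  `Re L(σ, χ) > 0` for all `σ > 0`.
* `LFunction_re_pos_of_twisted_summatory_two_nonneg` — **twisted criterion, order two**: the same
  conclusion if the summatory function of `n ↦ S_1(n, χ) + ∑ a_r S_1(⌊n/r⌋, χ)` is `≥ 0` from `1` on
  (second summation by parts, `two_mul_rpow_neg_lt` of the Even file).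

With `R = ∅` these are MV Exercise 11.2.1.7 (a) and (g) at `k = 2`
(`LFunction_re_pos_of_summatory_nonneg`, `LFunction_re_pos_of_iterSummatory_two_nonneg`).

## Status of the twist for `χ_{−163}` (audit notes, not formalised)

* Order one cannot be rescued by twists with pairwise coprime support: `S_1(32, χ_{−163}) = −6`,
  and for every `r ≥ 2` some residue `j (mod r)` has `S_1(⌊(163j + 32)/r⌋, χ_{−163}) ≤ 0`
  (checked for `r < 2000`; automatic for `r ≥ 13`, the steps `⌈163/r⌉ ≤ 13` not jumping over the
  thirteen consecutive negative values `S_1(27), …, S_1(39)`), so the Chinese remainder theorem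
  produces `N ≡ 32 (mod 163)` at which every twisted term is `≤ 0` and the main term is `−6`.
  Linear programming over divisor-closed supports (divisors of `2^{10}`, `24`, `60`, `72`; exact
  over a full period `163·lcm`) is infeasible as well (best `min_N` of the normalised twisted sum
  between `−0.59` and `−0.37`).
* Order two and higher with general weights: OPEN; a linear-programming search with exact
  certification over `N ≤ 164·max R` (order `2`; beyond that every term is positive) was run as a
  compute job of this audit — see the barrier entry's `evasions_known`. A success would be an
  elementary, kernel-checkable certificate that `L(s, χ_{−163})` has no zero in `(0, 1)` by a
  positivity argument, i.e. exactly what the catalogue entry says the technique cannot deliver for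
  this character in untwisted form.

## References

* [Rosser1950RealRoots] J. B. Rosser, *Real roots of real Dirichlet `L`-series*, J. Research Nat.
  Bur. Standards 45 (1950), 505–514, doi:10.6028/jres.045.058 (READ in full for this audit; page
  and theorem numbers above are from the paper).
* J. B. Rosser, *Real roots of Dirichlet `L`-series*, Bull. Amer. Math. Soc. 55 (1949), 906–913
  (read: `k ≤ 67` by moment expansions; footnote 2: all `k ≤ 227` except `148`, `163`).
* [MontgomeryVaughan2007] H. L. Montgomery, R. C. Vaughan, *Multiplicative Number Theory I*, CUP
  2007, §11.2.1 Exercises 7–8; §4.3 Thm. 4.8.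
* P. T. Bateman, G. B. Purdy, S. S. Wagstaff, *Some numerical results on Fekete polynomials*,
  Math. Comp. 29 (1975), 7–23 (read: §1, three quantitative forms of Heilbronn's theorem;
  "Chowla's method" as key word).

## Design notes

* As in the sibling files: `S_1(k, χ) = summatory (fun n ↦ Re χ(n)) k`; `⌊N/r⌋` is `ℕ`-division;
  the Abel weight `N^{−σ} − (N+1)^{−σ}` is written for `N : ℕ` with Mathlib's junk value at `N = 0`
  (`0^{−σ} = 0`), where it is always multiplied by `S_1(0) = 0`.
* The twist is normalised to `D(s) = 1 + ∑_{r ∈ R} a_r r^{−s}` (main term present); `1 ∈ R` is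
  allowed and only changes the main coefficient to `1 + a_1`.
-/

noncomputable section

open Complex Finset Filter Topology

namespace Literature.Barriers.RiemannHypothesis

/-! ## Rosser's twist: positive Dirichlet-polynomial multipliers (Rosser 1950, Theorems 5–6) -/

/-- Block identity behind Rosser's Theorem 5 in discrete (Abel-sum) form: for `r ≥ 1`,
`∑_{N < rV} S(⌊N/r⌋)(N^{-σ} − (N+1)^{-σ}) = r^{-σ} ∑_{v < V} S(v)(v^{-σ} − (v+1)^{-σ})`
for any `S : ℕ → ℝ` (the `r` consecutive `N` with `⌊N/r⌋ = v` telescope to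
`(vr)^{-σ} − (vr + r)^{-σ} = r^{-σ}(v^{-σ} − (v+1)^{-σ})`).
[cite: Rosser1950RealRoots, Theorem 5] -/
theorem sum_range_mul_apply_div_mul_rpow_sub (S : ℕ → ℝ) {r : ℕ} (hr : 0 < r)
    (σ : ℝ) (V : ℕ) :
    ∑ N ∈ range (r * V), S (N / r) * (((N : ℕ) : ℝ) ^ (-σ) - ((N + 1 : ℕ) : ℝ) ^ (-σ)) =
      ((r : ℕ) : ℝ) ^ (-σ) *
        ∑ v ∈ range V, S v * (((v : ℕ) : ℝ) ^ (-σ) - ((v + 1 : ℕ) : ℝ) ^ (-σ)) := by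
  induction V with
  | zero => simp
  | succ V ih =>
    rw [Nat.mul_succ, Finset.sum_range_add, ih, Finset.sum_range_succ, mul_add]
    congr 1
    have hdiv : ∀ x ∈ range r, (r * V + x) / r = V := fun x hx ↦ by
      rw [Nat.mul_add_div hr, Nat.div_eq_of_lt (mem_range.1 hx), add_zero]
    have htel : ∑ x ∈ range r, ((((r * V + x : ℕ) : ℕ) : ℝ) ^ (-σ) - ((r * V + x + 1 : ℕ) : ℝ) ^ (-σ)) =
        ((r * V : ℕ) : ℝ) ^ (-σ) - ((r * V + r : ℕ) : ℝ) ^ (-σ) := by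
      have := Finset.sum_range_sub' (fun x : ℕ ↦ ((r * V + x : ℕ) : ℝ) ^ (-σ)) r
      simpa [Nat.add_assoc] using this
    calc ∑ x ∈ range r, S ((r * V + x) / r) * ((((r * V + x : ℕ)) : ℝ) ^ (-σ) - ((r * V + x + 1 : ℕ) : ℝ) ^ (-σ))
        = ∑ x ∈ range r, S V * ((((r * V + x : ℕ)) : ℝ) ^ (-σ) - ((r * V + x + 1 : ℕ) : ℝ) ^ (-σ)) := by
          exact Finset.sum_congr rfl fun x hx ↦ by rw [hdiv x hx]
      _ = S V * (((r * V : ℕ) : ℝ) ^ (-σ) - ((r * V + r : ℕ) : ℝ) ^ (-σ)) := by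
          rw [← Finset.mul_sum, htel]
      _ = ((r : ℕ) : ℝ) ^ (-σ) * (S V * (((V : ℕ) : ℝ) ^ (-σ) - ((V + 1 : ℕ) : ℝ) ^ (-σ))) := by
          have h1 : ((r * V : ℕ) : ℝ) ^ (-σ) = ((r : ℕ) : ℝ) ^ (-σ) * ((V : ℕ) : ℝ) ^ (-σ) := by
            rw [Nat.cast_mul, Real.mul_rpow (Nat.cast_nonneg r) (Nat.cast_nonneg V)]
          have h2 : ((r * V + r : ℕ) : ℝ) ^ (-σ) = ((r : ℕ) : ℝ) ^ (-σ) * ((V + 1 : ℕ) : ℝ) ^ (-σ) := by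
            rw [← Real.mul_rpow (Nat.cast_nonneg r) (Nat.cast_nonneg (V + 1))]
            congr 1
            push_cast
            ring
          rw [h1, h2]
          ring

/-- **Rosser's Theorem 5 (1950), discrete form: the `r`-twisted Abel identity.** For `χ ≠ χ₀`
mod `m`, `r ≥ 1` and `σ > 0`,
`∑_{N ≥ 1} S_1(⌊N/r⌋, χ)(N^{-σ} − (N+1)^{-σ}) = r^{-σ} · Re L(σ, χ)`, where
`S_1(k, χ) = summatory (Re χ) k` — the series version of Rosser's
"`(1 + a r^{-s})F(s) = ∫_0^∞ x^{s−1}{f(x) + a f(rx)} dx`" for `F(s) = ∫ x^{s-1} f(x) dx`: the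
Dirichlet series `r^{-s} L(s, χ) = ∑ χ(n)(rn)^{-s}` has summatory coefficient function
`N ↦ S_1(⌊N/r⌋, χ)`. Proof: the partial sums over `N < rV` equal `r^{-σ}` times the partial
Abel sums of `L(σ, χ)` (`sum_range_mul_apply_div_mul_rpow_sub`), which tend to `Re L(σ, χ)`
(`Literature.NumberTheory.LFunctions.DirichletAbel.LFunction_eq_abelSum`, MV Thm. 4.8); the
series converges absolutely (`|S_1| ≤ m`, weights telescoping). The term `N = 0` is `0`
(`S_1(0) = 0`). [cite: Rosser1950RealRoots, Theorems 5–6] [cite: MontgomeryVaughan2007, §4.3 Thm. 4.8] -/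
theorem hasSum_summatory_div_mul_rpow_sub {m : ℕ} [NeZero m] (ψ : DirichletCharacter ℂ m)
    (hψ : ψ ≠ 1) {r : ℕ} (hr : 0 < r) {σ : ℝ} (hσ : 0 < σ) :
    HasSum (fun N : ℕ ↦ summatory (fun n ↦ (ψ (n : ZMod m)).re) (N / r) *
        (((N : ℕ) : ℝ) ^ (-σ) - ((N + 1 : ℕ) : ℝ) ^ (-σ)))
      (((r : ℕ) : ℝ) ^ (-σ) * (ψ.LFunction (σ : ℂ)).re) := by
  set g : ℕ → ℝ := fun n ↦ (ψ (n : ZMod m)).re with hg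
  set w : ℕ → ℝ := fun N ↦ ((N : ℕ) : ℝ) ^ (-σ) - ((N + 1 : ℕ) : ℝ) ^ (-σ) with hw
  set F : ℕ → ℝ := fun N ↦ summatory g (N / r) * w N with hF
  -- Step 1: `|S_1(k)| ≤ m` and summability of `F`
  have hbound : ∀ k, |summatory g k| ≤ m := fun k ↦ by
    rw [← re_partialSum_eq_summatory]
    exact (Complex.abs_re_le_norm _).trans
      (Literature.NumberTheory.LFunctions.DirichletAbel.norm_partialSum_le ψ hψ k)
  have hwpos : ∀ n : ℕ, 0 < w (n + 1) := fun n ↦ by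
    simpa [hw] using rpow_neg_sub_rpow_neg_succ_pos n hσ
  have hwsum : Summable fun n : ℕ ↦ w (n + 1) := by
    refine summable_of_sum_range_le (c := 1) (fun n ↦ (hwpos n).le) fun n ↦ ?_
    have htel := Finset.sum_range_sub' (fun i : ℕ ↦ ((i + 1 : ℕ) : ℝ) ^ (-σ)) n
    have h1 : ∑ i ∈ range n, w (i + 1) = ((0 + 1 : ℕ) : ℝ) ^ (-σ) - ((n + 1 : ℕ) : ℝ) ^ (-σ) := by
      rw [← htel]
    rw [h1]
    have : (0 : ℝ) ≤ ((n + 1 : ℕ) : ℝ) ^ (-σ) := by positivity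
    simp only [zero_add, Nat.cast_one, Real.one_rpow]
    linarith
  have hFsum' : Summable fun n : ℕ ↦ F (n + 1) := by
    refine Summable.of_norm_bounded (g := fun n : ℕ ↦ (m : ℝ) * w (n + 1)) (hwsum.mul_left _)
      fun n ↦ ?_
    rw [hF]
    dsimp only
    rw [Real.norm_eq_abs, abs_mul, abs_of_pos (hwpos n)]
    exact mul_le_mul_of_nonneg_right (hbound _) (hwpos n).le
  have hFsum : Summable F := (summable_nat_add_iff 1).mp hFsum'
  -- Step 2: the untwisted partial sums tend to `Re L(σ, χ)`
  have hs : 0 < (σ : ℂ).re := by simpa using hσ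
  have hsumT := Literature.NumberTheory.LFunctions.DirichletAbel.summable_term ψ hψ hs
  have hlim : Tendsto
      (fun M ↦ ∑ n ∈ range M, (Literature.NumberTheory.LFunctions.DirichletAbel.term ψ n σ).re)
      atTop (𝓝 (ψ.LFunction (σ : ℂ)).re) := by
    rw [Literature.NumberTheory.LFunctions.DirichletAbel.LFunction_eq_abelSum ψ hψ hs,
      Literature.NumberTheory.LFunctions.DirichletAbel.abelSum]
    exact (Complex.hasSum_re hsumT.hasSum).tendsto_sum_nat
  have hterm : ∀ n, (Literature.NumberTheory.LFunctions.DirichletAbel.term ψ n σ).re =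
      summatory g (n + 1) * w (n + 1) := fun n ↦ by
    rw [re_abelTerm_ofReal]
  have hlim1 : Tendsto (fun V ↦ ∑ v ∈ range V, summatory g v * w v) atTop
      (𝓝 (ψ.LFunction (σ : ℂ)).re) := by
    refine (tendsto_add_atTop_iff_nat 1).mp ?_
    have : (fun V ↦ ∑ v ∈ range (V + 1), summatory g v * w v) =
        fun V ↦ ∑ n ∈ range V, (Literature.NumberTheory.LFunctions.DirichletAbel.term ψ n σ).re := by
      funext V
      rw [Finset.sum_range_succ']
      simp [hterm, hg]
    rw [this]
    exact hlim
  -- Step 3: along `M = rV` the twisted partial sums are `r^{-σ}` times the untwisted ones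
  have hlim2 : Tendsto (fun V ↦ ∑ N ∈ range (r * V), F N) atTop
      (𝓝 (((r : ℕ) : ℝ) ^ (-σ) * (ψ.LFunction (σ : ℂ)).re)) := by
    have : (fun V ↦ ∑ N ∈ range (r * V), F N) =
        fun V ↦ ((r : ℕ) : ℝ) ^ (-σ) * ∑ v ∈ range V, summatory g v * w v := by
      funext V
      exact sum_range_mul_apply_div_mul_rpow_sub (summatory g) hr σ V
    rw [this]
    exact hlim1.const_mul _
  -- Step 4: the full sequence of partial sums converges (summability); compare along `rV`
  have hlim3 : Tendsto (fun V ↦ ∑ N ∈ range (r * V), F N) atTop (𝓝 (∑' N, F N)) := by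
    have h := hFsum.hasSum.tendsto_sum_nat
    have hrV : Tendsto (fun V : ℕ ↦ r * V) atTop atTop :=
      tendsto_atTop_mono (fun V ↦ Nat.le_mul_of_pos_left V hr) tendsto_id
    exact h.comp hrV
  have heq : ∑' N, F N = ((r : ℕ) : ℝ) ^ (-σ) * (ψ.LFunction (σ : ℂ)).re :=
    tendsto_nhds_unique hlim3 hlim2
  exact hFsum.hasSum_iff.mpr heq

/-- **Rosser's twisted Fekete–Pólya criterion (1950, Theorems 5–6, order one), PROVED.** Let
`χ ≠ χ₀` be a Dirichlet character mod `m`, `R` a finite set of integers `r ≥ 1` with weights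
`a_r ≥ 0`, and suppose the twisted summatory function is nonnegative:
`S_1(N, χ) + ∑_{r ∈ R} a_r S_1(⌊N/r⌋, χ) ≥ 0` for all `N ≥ 1` — these are the partial sums of
the coefficients of `(1 + ∑_{r ∈ R} a_r r^{-s}) L(s, χ)` (Rosser: "`θ(n)` is the coefficient of
`n^{-s}` in the Dirichlet series expansion of `(1 + a r^{-s})L(s, φ)`", Theorem 6). Then
`Re L(σ, χ) > 0` for every `σ > 0`: by `hasSum_summatory_div_mul_rpow_sub`,
`(1 + ∑ a_r r^{-σ}) Re L(σ, χ) = ∑_{N ≥ 1} [S_1(N) + ∑ a_r S_1(⌊N/r⌋)](N^{-σ} − (N+1)^{-σ})`,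
a series of nonnegative terms whose term `N = 1` is at least `1 − 2^{-σ} > 0`. The case
`R = ∅` is MV Exercise 11.2.1.7 (a) (`LFunction_re_pos_of_summatory_nonneg`); `R = {p}`,
`a_p = 1` with `χ(p) = −1` is the induced character `χ↑(pm)` (Chowla); Rosser handled every
modulus `k ≤ 227` except `163` with such products and wrote that for `k = 163` "the
combination ... will require at least five factors, and likely more than five".
[cite: Rosser1950RealRoots, Theorems 5–6] [cite: MontgomeryVaughan2007, §11.2.1 Exercise 8] -/
theorem LFunction_re_pos_of_twisted_summatory_nonneg {m : ℕ} [NeZero m]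
    (ψ : DirichletCharacter ℂ m) (hψ : ψ ≠ 1) (R : Finset ℕ) (a : ℕ → ℝ)
    (hR : ∀ r ∈ R, 0 < r) (ha : ∀ r ∈ R, 0 ≤ a r)
    (hS : ∀ N : ℕ, 1 ≤ N →
      0 ≤ summatory (fun n ↦ (ψ (n : ZMod m)).re) N +
        ∑ r ∈ R, a r * summatory (fun n ↦ (ψ (n : ZMod m)).re) (N / r))
    {σ : ℝ} (hσ : 0 < σ) : 0 < (ψ.LFunction (σ : ℂ)).re := by
  set g : ℕ → ℝ := fun n ↦ (ψ (n : ZMod m)).re with hg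
  set w : ℕ → ℝ := fun N ↦ ((N : ℕ) : ℝ) ^ (-σ) - ((N + 1 : ℕ) : ℝ) ^ (-σ) with hw
  set L : ℝ := (ψ.LFunction (σ : ℂ)).re with hL
  -- the twisted series and its sum
  set c : ℕ → ℝ := fun N ↦ (summatory g N + ∑ r ∈ R, a r * summatory g (N / r)) * w N with hc
  have h1 : HasSum (fun N : ℕ ↦ summatory g (N / 1) * w N) (((1 : ℕ) : ℝ) ^ (-σ) * L) :=
    hasSum_summatory_div_mul_rpow_sub ψ hψ Nat.one_pos hσ
  simp only [Nat.div_one, Nat.cast_one, Real.one_rpow, one_mul] at h1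
  have h2 : ∀ r ∈ R, HasSum (fun N : ℕ ↦ a r * (summatory g (N / r) * w N))
      (a r * (((r : ℕ) : ℝ) ^ (-σ) * L)) := fun r hr ↦
    (hasSum_summatory_div_mul_rpow_sub ψ hψ (hR r hr) hσ).mul_left (a r)
  have h3 : HasSum (fun N : ℕ ↦ ∑ r ∈ R, a r * (summatory g (N / r) * w N))
      (∑ r ∈ R, a r * (((r : ℕ) : ℝ) ^ (-σ) * L)) := hasSum_sum h2
  have hcsum : HasSum c (L + ∑ r ∈ R, a r * (((r : ℕ) : ℝ) ^ (-σ) * L)) := by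
    have := h1.add h3
    refine this.congr_fun fun N ↦ ?_
    rw [hc]
    dsimp only
    rw [add_mul, Finset.sum_mul]
    refine congrArg _ (Finset.sum_congr rfl fun r _ ↦ by ring)
  -- the sum is `D(σ) · L` with `D(σ) = 1 + ∑ a_r r^{-σ} > 0`
  have hD : L + ∑ r ∈ R, a r * (((r : ℕ) : ℝ) ^ (-σ) * L) =
      (1 + ∑ r ∈ R, a r * ((r : ℕ) : ℝ) ^ (-σ)) * L := by
    rw [add_mul, one_mul, Finset.sum_mul]
    refine congrArg _ (Finset.sum_congr rfl fun r _ ↦ by ring)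
  have hDpos : 0 < 1 + ∑ r ∈ R, a r * ((r : ℕ) : ℝ) ^ (-σ) :=
    add_pos_of_pos_of_nonneg one_pos (sum_nonneg fun r hr ↦ mul_nonneg (ha r hr) (by positivity))
  -- every term is `≥ 0` and the term `N = 1` is `> 0`
  have hwpos : ∀ n : ℕ, 0 < w (n + 1) := fun n ↦ by
    simpa [hw] using rpow_neg_sub_rpow_neg_succ_pos n hσ
  have hc0 : c 0 = 0 := by simp [hc, summatory_zero]
  have hcnn : ∀ N, 0 ≤ c N := by
    intro N
    rcases N with _ | n
    · rw [hc0]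
    · exact mul_nonneg (hS (n + 1) (Nat.succ_pos n)) (hwpos n).le
  have hS1 : summatory g 1 = 1 := by
    rw [summatory_succ, summatory_zero]
    simp [hg]
  have hc1 : 0 < c 1 := by
    have hsum1 : 0 ≤ ∑ r ∈ R, a r * summatory g (1 / r) := by
      refine sum_nonneg fun r hr ↦ mul_nonneg (ha r hr) ?_
      rcases Nat.lt_or_ge 1 r with h | h
      · rw [Nat.div_eq_of_lt h, summatory_zero]
      · have : r = 1 := le_antisymm h (hR r hr)
        rw [this, Nat.div_one, hS1]
        exact zero_le_one
    have : 0 < summatory g 1 + ∑ r ∈ R, a r * summatory g (1 / r) := by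
      rw [hS1]; linarith
    exact mul_pos this (hwpos 0)
  have hpos : 0 < ∑' N, c N := hcsum.summable.tsum_pos hcnn 1 hc1
  rw [hcsum.tsum_eq, hD] at hpos
  exact pos_of_mul_pos_right hpos hDpos.le

/-- `∑_{j < k} C(j+1) = summatory C k` for any `C : ℕ → ℝ`. [folklore] -/
theorem sum_range_apply_succ_eq_summatory (C : ℕ → ℝ) (k : ℕ) :
    ∑ j ∈ range k, C (j + 1) = summatory C k := by
  induction k with
  | zero => simp
  | succ k ih => rw [sum_range_succ, ih, summatory_succ]

/-- **Rosser's twisted criterion at order two, PROVED** (Rosser 1950, Theorems 5–6 with `r = 2`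
iterated sums: "`θ_2(n) ≥ 0`"). Let `χ ≠ χ₀` mod `m`, `R` a finite set of integers `r ≥ 1`
with weights `a_r ≥ 0`, `C(n) = S_1(n, χ) + ∑_{r ∈ R} a_r S_1(⌊n/r⌋, χ)` the summatory function
of the coefficients of `(1 + ∑ a_r r^{-s})L(s, χ)`, and suppose its summatory function is
nonnegative: `∑_{n=1}^{N} C(n) ≥ 0` for all `N ≥ 1`. Then `Re L(σ, χ) > 0` for every `σ > 0`:
`(1 + ∑ a_r r^{-σ}) Re L(σ, χ) = ∑_N C(N)(N^{-σ} − (N+1)^{-σ})`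
(`hasSum_summatory_div_mul_rpow_sub`), and a second summation by parts as in
`LFunction_re_pos_of_iterSummatory_two_nonneg` (positivity of the second differences
`Δ_2(n^{-σ})`, `two_mul_rpow_neg_lt`) bounds the partial sums below by
`C(1)(1 − 2·2^{-σ} + 3^{-σ}) ≥ 1 − 2·2^{-σ} + 3^{-σ} > 0`. With `R = ∅` this is MV Exercise
11.2.1.7 (g) at `k = 2`. A finite nonnegative twist `a` satisfying the hypothesis for
`χ_{−163}` would certify `L(σ, χ_{−163}) > 0` on `σ > 0` although every untwisted order fails
(`iterSummatory_chi163_neg`); whether one exists is open (barrier audit 2026-08-16).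
[cite: Rosser1950RealRoots, Theorems 5–6] [cite: MontgomeryVaughan2007, §11.2.1 Exercise 7 (f), (g)] -/
theorem LFunction_re_pos_of_twisted_summatory_two_nonneg {m : ℕ} [NeZero m]
    (ψ : DirichletCharacter ℂ m) (hψ : ψ ≠ 1) (R : Finset ℕ) (a : ℕ → ℝ)
    (hR : ∀ r ∈ R, 0 < r) (ha : ∀ r ∈ R, 0 ≤ a r)
    (hS : ∀ N : ℕ, 1 ≤ N →
      0 ≤ summatory (fun n ↦ summatory (fun k ↦ (ψ (k : ZMod m)).re) n +
        ∑ r ∈ R, a r * summatory (fun k ↦ (ψ (k : ZMod m)).re) (n / r)) N)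
    {σ : ℝ} (hσ : 0 < σ) : 0 < (ψ.LFunction (σ : ℂ)).re := by
  set g : ℕ → ℝ := fun n ↦ (ψ (n : ZMod m)).re with hg
  set w : ℕ → ℝ := fun N ↦ ((N : ℕ) : ℝ) ^ (-σ) - ((N + 1 : ℕ) : ℝ) ^ (-σ) with hw
  set L : ℝ := (ψ.LFunction (σ : ℂ)).re with hL
  set C : ℕ → ℝ := fun N ↦ summatory g N + ∑ r ∈ R, a r * summatory g (N / r) with hC
  -- the twisted series `∑ C(N) w(N)` sums to `D(σ) L`
  have h1 : HasSum (fun N : ℕ ↦ summatory g (N / 1) * w N) (((1 : ℕ) : ℝ) ^ (-σ) * L) :=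
    hasSum_summatory_div_mul_rpow_sub ψ hψ Nat.one_pos hσ
  simp only [Nat.div_one, Nat.cast_one, Real.one_rpow, one_mul] at h1
  have h2 : ∀ r ∈ R, HasSum (fun N : ℕ ↦ a r * (summatory g (N / r) * w N))
      (a r * (((r : ℕ) : ℝ) ^ (-σ) * L)) := fun r hr ↦
    (hasSum_summatory_div_mul_rpow_sub ψ hψ (hR r hr) hσ).mul_left (a r)
  have h3 : HasSum (fun N : ℕ ↦ ∑ r ∈ R, a r * (summatory g (N / r) * w N))
      (∑ r ∈ R, a r * (((r : ℕ) : ℝ) ^ (-σ) * L)) := hasSum_sum h2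
  have hcsum : HasSum (fun N ↦ C N * w N) (L + ∑ r ∈ R, a r * (((r : ℕ) : ℝ) ^ (-σ) * L)) := by
    refine (h1.add h3).congr_fun fun N ↦ ?_
    rw [hC]
    dsimp only
    rw [add_mul, Finset.sum_mul]
    refine congrArg _ (Finset.sum_congr rfl fun r _ ↦ by ring)
  have hD : L + ∑ r ∈ R, a r * (((r : ℕ) : ℝ) ^ (-σ) * L) =
      (1 + ∑ r ∈ R, a r * ((r : ℕ) : ℝ) ^ (-σ)) * L := by
    rw [add_mul, one_mul, Finset.sum_mul]
    refine congrArg _ (Finset.sum_congr rfl fun r _ ↦ by ring)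
  have hDpos : 0 < 1 + ∑ r ∈ R, a r * ((r : ℕ) : ℝ) ^ (-σ) :=
    add_pos_of_pos_of_nonneg one_pos (sum_nonneg fun r hr ↦ mul_nonneg (ha r hr) (by positivity))
  -- partial sums of the shifted series `n ↦ C(n+1) w(n+1)` tend to `D(σ) L`
  have hC0 : C 0 = 0 := by simp [hC, summatory_zero]
  have hlim : Tendsto (fun M ↦ ∑ n ∈ range M, w (n + 1) * C (n + 1)) atTop
      (𝓝 ((1 + ∑ r ∈ R, a r * ((r : ℕ) : ℝ) ^ (-σ)) * L)) := by
    rw [← hD]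
    have h := ((hasSum_nat_add_iff' 1).mpr hcsum).tendsto_sum_nat
    simp only [sum_range_one, hC0, zero_mul, sub_zero] at h
    exact h.congr fun M ↦ Finset.sum_congr rfl fun n _ ↦ mul_comm _ _
  -- second summation by parts (as in `LFunction_re_pos_of_iterSummatory_two_nonneg`)
  set b : ℕ → ℝ := fun n ↦ w (n + 1) with hb
  have hb_pos : ∀ n, 0 < b n := fun n ↦ by
    simpa [hb, hw] using rpow_neg_sub_rpow_neg_succ_pos n hσ
  have hconv : ∀ n, b (n + 1) < b n := fun n ↦ by
    have := two_mul_rpow_neg_lt n hσ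
    simp only [hb, hw]
    push_cast at this ⊢
    linarith
  have hP : ∀ K, ∑ n ∈ range (K + 1 + 1), b n * C (n + 1) =
      b (K + 1) * summatory C (K + 1 + 1) +
        ∑ i ∈ range (K + 1), (b i - b (i + 1)) * summatory C (i + 1) := by
    intro K
    have hbp := Finset.sum_range_by_parts b (fun j ↦ C (j + 1)) (K + 1 + 1)
    simp only [smul_eq_mul, Nat.add_sub_cancel, sum_range_apply_succ_eq_summatory] at hbp
    rw [hbp, sub_eq_add_neg, ← Finset.sum_neg_distrib]
    congr 1
    exact Finset.sum_congr rfl fun i _ ↦ by ring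
  have hS1 : summatory g 1 = 1 := by
    rw [summatory_succ, summatory_zero]
    simp [hg]
  have hC1 : 1 ≤ C 1 := by
    have hsum1 : 0 ≤ ∑ r ∈ R, a r * summatory g (1 / r) := by
      refine sum_nonneg fun r hr ↦ mul_nonneg (ha r hr) ?_
      rcases Nat.lt_or_ge 1 r with h | h
      · rw [Nat.div_eq_of_lt h, summatory_zero]
      · have : r = 1 := le_antisymm h (hR r hr)
        rw [this, Nat.div_one, hS1]
        exact zero_le_one
    simp only [hC, hS1]
    linarith
  have hSC1 : summatory C 1 = C 1 := by rw [summatory_succ, summatory_zero, zero_add]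
  have hlow : ∀ K, b 0 - b 1 ≤ ∑ n ∈ range (K + 1 + 1), b n * C (n + 1) := by
    intro K
    rw [hP]
    have h1 : 0 ≤ b (K + 1) * summatory C (K + 1 + 1) :=
      mul_nonneg (hb_pos _).le (hS _ (by omega))
    have h2 : 0 ≤ ∑ i ∈ range K, (b (i + 1) - b (i + 1 + 1)) * summatory C (i + 1 + 1) :=
      sum_nonneg fun i _ ↦ mul_nonneg (sub_nonneg.2 (hconv _).le) (hS _ (by omega))
    rw [Finset.sum_range_succ', hSC1]
    have h3 : b 0 - b 1 ≤ (b 0 - b (0 + 1)) * C 1 := by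
      have := sub_pos.2 (hconv 0)
      nlinarith
    linarith
  have hc : 0 < b 0 - b 1 := sub_pos.2 (hconv 0)
  have hev : ∀ᶠ M in atTop, b 0 - b 1 ≤ ∑ n ∈ range M, b n * C (n + 1) := by
    rw [Filter.eventually_atTop]
    refine ⟨2, fun M hM ↦ ?_⟩
    obtain ⟨K, rfl⟩ : ∃ K, M = K + 1 + 1 := ⟨M - 2, by omega⟩
    exact hlow K
  have hpos : 0 < (1 + ∑ r ∈ R, a r * ((r : ℕ) : ℝ) ^ (-σ)) * L :=
    lt_of_lt_of_le hc (ge_of_tendsto hlim hev)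
  exact pos_of_mul_pos_right hpos hDpos.le

end Literature.Barriers.RiemannHypothesis

end
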